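import Mathlib
import Literature.NumberTheory.LFunctions.FeketePolynomial
import Summits.ValiantsHypothesis.ValiantsHypothesis.Theses.FeketeSOS
import Summits.ValiantsHypothesis.ValiantsHypothesis.Theorems.FeketeSOSHard.Negative.LoadBearing
import Summits.ValiantsHypothesis.ValiantsHypothesis.Theorems.SOSMagnification.Negative.FeketeTwoSquaresStructure
import Summits.ValiantsHypothesis.ValiantsHypothesis.Theorems.FeketeSOSThinSquaresCovering
import Summits.ValiantsHypothesis.ValiantsHypothesis.Theorems.FeketeSOSFeketeNoSparseSplit
import Summits.ValiantsHypothesis.ValiantsHypothesis.Theorems.SublinearShadow.Negative.DeepFamily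

/-!
# Disproof of `SublinearShadow` — findings (standing disprover `cdisprove`, gen 1, cycle 1; v2 2026-08-16)

Crux `stmt-ValiantsHypothesis-14990` = `Summit.ValiantsHypothesis.ValiantsHypothesis.Theses.FeketeSOS.SublinearShadow`
(route FeketeSOS, rank 5; line `Sketch`, `Cruxes/SublinearShadow/Lines/Sketch.lean`):
`∃ A p₁ ∀ primes p ≥ p₁ ∀ (s, c, g)`, `deg g_i ≤ p²`, `S⁴ ≤ p³` (`S = Σ_i |supp g_i|`), `Σ c_i g_i² = F_p` over `ℂ`
`⟹` a field `K` of characteristic `p`, `d ≤ (s+1)^A` weighted squares `g'_j ∈ K[X]` of degree `< p`, total support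
`≤ (s+1)^A · S`, with `X^p − 1 ∣ Σ c'_j g'_j² − F̄_p` (`HasShadow p ((s+1)^A) ((s+1)^A·S)` below).

## VERDICT (cycle 1): NO KILL — and none is possible with present knowledge: the crux sits behind a DOUBLE WALL (§W).
`not_sublinearShadow_iff`: `¬SublinearShadow ⟺ ∀ A p₁ ∃ prime p ≥ p₁ ∃` a SUBLINEAR complex representation `(s, S)` of
`F_p` admitting NO characteristic-`p` cyclic representation with `≤ (s+1)^A` squares and support `≤ (s+1)^A·S`.  So a
refutation must, at the same primes,
* (W1) EXHIBIT sublinear complex SOS representations of `F_p` (`S ≤ p^{3/4}`, necessarily `s ≥ 3` squares, §V) — none is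
  known for any `p`; exhaustive minima `S_min(F_5) = 5`, `S_min(F_7) = 7`, `S_min(F_11) ≥ 9` (kit j009087, sibling file
  `Cruxes/FeketeSOSHard/Disproof.lean`), fixed-fan-in shapes linear (`≈ 0.7p…p`, `p ≤ 61`, `Cruxes/FeketeBoundedFanin/
  Disproof.lean §C`); this is kill criterion (iv) of the thesis `X` itself (`sublinearShadow_of_noSublinearRep`: if the
  class is empty for large `p` the crux is TRUE, vacuously — i.e. the crux is implied by `X` at exponent `3/4`, all `s`);
* (W2) PROVE that `F̄_p` has no cyclic char-`p` representation with `D` squares and support `≤ D·S` — with `S ≥ √(2(p−1)) − 1`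
  this is a bounded-fan-in char-`p` lower bound beating COUNTING by the constant factor `D` for every `D`
  (`sublinearShadow_of_cheapCharP`: if for some `D` and all large `p` a `D`-square cyclic representation of support `T` with
  `2T² ≤ D²(p−1)` exists, the crux is TRUE, trivially); for `D ≤ 2` the linear bound `(p+3)/2` is a theorem
  (`feketeNoSparseCyclicSplit`), for `D ≥ 3` nothing beyond counting is known — it is a weak form of the sibling crux (★)
  `CharPSparseSOS`.
Every variant that keeps "a sublinear complex representation of `F_p`" among its hypotheses (drop the degree cap, drop or
keep `S⁴ ≤ p³`, insist on `K = 𝔽_p`, on `d ≤ s`, on `A = 0`, on explicit `p₁`) inherits W1 and is irrefutable today; every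
general-target variant ("all `f ∈ ℤ[X]`") inherits W2 (positive depth needs `s ≥ 3` — one term and one product always
have good reduction — and no char-`p` bound for `≥ 3` squares exists beyond counting, which never separates `T` from `S`).

## What IS proved here (all `sorry`-free).  LANDED: `Theorems/SublinearShadow/Negative/DeepFamily.lean` (p98550, ACCEPTED: §A, §B
## deep family + padding); PENDING: `Negative/KillCriterion.lean` (p101954: W1/W2 as `¬SublinearShadow → …`), `Negative/MinimalDeep.lean`
## (§B `fekete_five_deep_minimal`, `not_cheap_rep_goodReduction`; gate permission stage flaky at 13:15Z, to be re-proposed / attached).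
* §0 `HasShadow`, `sublinearShadow_iff` (read-back, `Iff.rfl`), `hasShadow_mono`; `s ≥ 2` always (`F_p ≠ 0`, `≠ c·g²`) is the
  landed `SOSMagnification.Negative.two_le_of_feketeRep`, reused.
* §W `not_sublinearShadow_iff`, `sublinearShadow_of_noSublinearRep` (W1), `sublinearShadow_of_cheapCharP` (W2).
* §V VACUITY SLICES: `three_le_of_sublinearRep` — for `p ≥ 257` a representation with `S⁴ ≤ p³` has `s ≥ 3` (two squares
  split, `SplitOfTwoSquares` + `feketeNoSparseCyclicSplit`: `4S ≥ p + 2`, `(p+2)⁴ > 256p³`).  This is VERBATIM the lead's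
  `stub_threeSquares` of line `Sketch`, which a prover landed meanwhile (`Theorems/FeketeSOSSublinearShadowThreeSquares.lean`);
  my copy `Negative/Vacuity.lean` was therefore NOT proposed (near-duplicate).  VACUITY CENSUS (kit j017676, j017691; exact:
  combinatorial filter + Gröbner bases over `ℚ` with Rabinowitsch, script `main.py` attached): the crux's hypothesis class is
  EMPTY at `p = 13` (`S ≤ 6`; ONE support pattern `{0}+{0,1,3,5,6}` passes coverage/lone-pair filters and dies on
  `[X¹²],[X¹¹],[X¹⁰]`: `f² = e² = 1`, `2ef = −1`; complete for ALL degrees — an exponent `M` with `2M ≥ p` must sit in two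
  supports, impossible here) and at `p = 17` (`S ≤ 8`, exponents `≤ 16`: 35 patterns pass the filters, all 35 infeasible by GB;
  exponents `≤ 24` as control, and `p = 19, 23` in j017691 — see `resists_remark` (2) for the final table).
* §A LOAD-BEARING: `sublinearShadow_false_without_rep` — delete `Σ c_i g_i² = F_p` and the statement is false (`s = 0`
  forces `X^p − 1 ∣ F̄_p ≠ 0`, `deg < p`).  The other single-hypothesis mutations are not refutable (W1/W2 above): the
  degree cap and `S⁴ ≤ p³` only SHRINK the class; the threshold `p₁` is existential; small `p` are vacuous (§R).
* §B DEPTH (the open core of line `Sketch` is the `p`-adically deep case): `exists_deep_threeSquares` — for EVERY prime `p`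
  and every `k`, `F_p = ¼(A+B)² − ¼(A−B)² − p^{−(k+1)}·1²` (`A = X − α`, `A·B = F_p + p^{−(k+1)}`): three squares, degree
  `≤ p²`, support `≤ 2p + 5`, and the scalar term is non-integral at EVERY valuation ring of `ℂ` above `p` even after
  multiplication by `p^j`, `j ≤ k` — DEPTH IS UNBOUNDED AT FAN-IN 3 AND LINEAR COST, so no depth / window-order /
  ramification budget `≤ poly(s)` follows from the target and the shape of the equations: the budget stub MUST consume
  the cost hypotheses (`S⁴ ≤ p³`, `(s+1)^B·S < 2p`) or Pareto-minimality (sharpens `BarrierNotes-ideator2 §B1`, stated for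
  general right-hand sides, to `F_p` itself); `exists_deep_padding` — `+p^{−(k+1)}·1² − p^{−(k+1)}·1²` turns ANY
  representation of cost `(s, S)` into a deep one of cost `(s+2, S+2)`: if the sublinear class is inhabited at all it
  contains representations with no place of good reduction, so inside the crux's hypotheses the deep case is excluded by
  Pareto-minimality ONLY (as `stub_orderBudgetFew` does), never by sublinearity; and `fekete_five_deep_minimal` /
  `not_cheap_rep_goodReduction` (NEW, §B; `Negative/MinimalDeep.lean` pending) — PARETO-MINIMALITY DOES NOT BUY GOOD REDUCTION
  EITHER: `F_5 = (X² − ½X)² − ⅕(1 − (5/2)X)² + ⅕·1²` has total support `5 = S_min(F_5)` (fewest monomials over ALL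
  representations, any `s`, any degrees: j009087 + hand proof in `resists_remark` (2)), three squares, and its two scalar-carrying
  terms have constant coefficients `∓⅕` — deep at EVERY place over `5`, the deep terms cancelling to the integral `X − (5/4)X²`;
  so "every representation with `≤ p` monomials has a place of good reduction" is false (`p = 5`), and a minimal few-square
  representation of a Fekete polynomial can be everywhere deep (other minimal representations of `F_5` are `5`-integral:
  minimality neither forces nor excludes depth).
* §L LINE `Sketch` AUDIT (payload.line; no stuck stubs yet): skeleton `lean check` rc 0, 7 sorries all in `stub_*`,
  composition `SublinearShadow_of` kernel-checked modulo stubs (joint sufficiency certified).  Per stub: `stub_evalSupport`,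
  `stub_windowDFT` (DFT coefficient extraction needs only `m > 2v` since `deg_Π ≤ 3v`), `stub_primRoot` (one of `2v+1, 2v+2`
  is prime to `p`), `stub_reindex` — landed (p96243/p96550/p96249/p96316), true; `stub_trivialShadow`, `stub_threeSquares`,
  `shadow_of_window` + `sublinearShadow_of_orderBudget` — landed by provers since (`FeketeSOSSublinearShadow{TrivialShadow,
  ThreeSquares,WindowReduction}.lean`), true (`stub_threeSquares` also proved independently here, §V); `stub_orderBudgetFew` — the open core,
  behind W1 (its hypothesis is a sublinear Pareto-minimal few-square representation): NOT refutable; note its conclusion is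
  EXISTENTIAL in the window model (not "the given representation has depth `≤ v`"), so on dense supports order `v = 0` is
  always available (`F̄ = ¼(X + Q̄)² − ¼(X − Q̄)²`, `F̄ = X·Q̄`) — the stub has content only because the digits must live
  on the SPARSE supports `supp g_i`; §B says the deep representations it must handle exist at every depth.
* §R remarks: small models / vacuity at small `p`, the shape of a kill, near-misses (none).

## Targets
None yet (payload `stuck_stubs = []`, `targets = []`).  When the lead posts STUCK stubs they go here as `<stub>_false` attempts.
-/

namespace Summit.ValiantsHypothesis.ValiantsHypothesis.Cruxes.SublinearShadow.Disproof

open Polynomial Finset IsLocalRing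
open scoped BigOperators
open Literature.NumberTheory.LFunctions
open Summit.ValiantsHypothesis.ValiantsHypothesis.Theses.FeketeSOS
open Summit.ValiantsHypothesis.ValiantsHypothesis.Theorems
open Summit.ValiantsHypothesis.ValiantsHypothesis.Theorems.FeketeSOSHard.Negative
  (card_support_add_le card_support_sub_le)
open Summit.ValiantsHypothesis.ValiantsHypothesis.Theorems.SOSMagnification.Negative (two_le_of_feketeRep)

-- `Summit.ValiantsHypothesis.ValiantsHypothesis.…` is the tree's mandated single-conjunct layout (Sub = Summit).
set_option linter.dupNamespace false

noncomputable section

/-- `𝔉⟮p⟯ = F_p = ∑_{m<p} (m|p) X^m`, the crux's literal right-hand side over `ℂ`. -/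
local notation3 "𝔉⟮" p "⟯" =>
  (∑ m ∈ Finset.range p, Polynomial.C ((legendreSym p m : ℤ) : ℂ) * (Polynomial.X : Polynomial ℂ) ^ m)

/-! ## §0 Read-back -/

/-- A cyclic characteristic-`p` shadow of `F̄_p` with at most `D` weighted squares of degree `< p` and total support
`≤ T` — verbatim the conclusion block of the crux with its two budgets exposed. [folklore] -/
def HasShadow (p : ℕ) [Fact p.Prime] (D T : ℕ) : Prop :=
  ∃ (K : Type) (_ : Field K) (_ : CharP K p) (d : ℕ) (c' : Fin d → K) (g' : Fin d → Polynomial K),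
    d ≤ D ∧ (∀ j, (g' j).natDegree < p) ∧ (∑ j, (g' j).support.card) ≤ T ∧
    ((Polynomial.X : Polynomial K) ^ p - 1 ∣ (∑ j, Polynomial.C (c' j) * g' j ^ 2)
      - ∑ m ∈ Finset.range p, Polynomial.C ((legendreSym p m : ℤ) : K) * Polynomial.X ^ m)

/-- Read-back: the crux is `∃ A p₁ ∀ p ≥ p₁ ∀ (s,c,g)`, degree cap, `S⁴ ≤ p³`, representation
`⟹ HasShadow p ((s+1)^A) ((s+1)^A · S)` — by `Iff.rfl`.  All arithmetic is in `ℕ`; no junk operators; `legendreSym p 0 = 0`. -/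
theorem sublinearShadow_iff :
    SublinearShadow ↔ ∃ A p₁ : ℕ, ∀ (p : ℕ) [Fact p.Prime], p₁ ≤ p →
      ∀ (s : ℕ) (c : Fin s → ℂ) (g : Fin s → ℂ[X]), (∀ i, (g i).natDegree ≤ p ^ 2) →
        (∑ i, (g i).support.card) ^ 4 ≤ p ^ 3 → (∑ i, C (c i) * g i ^ 2) = 𝔉⟮p⟯ →
        HasShadow p ((s + 1) ^ A) ((s + 1) ^ A * ∑ i, (g i).support.card) :=
  Iff.rfl

/-- Budgets are monotone. [folklore] -/
theorem hasShadow_mono {p : ℕ} [Fact p.Prime] {D T D' T' : ℕ} (h : HasShadow p D T) (hD : D ≤ D')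
    (hT : T ≤ T') : HasShadow p D' T' := by
  obtain ⟨K, iF, iC, d, c', g', hd, hdeg, hsupp, hdvd⟩ := h
  exact ⟨K, iF, iC, d, c', g', hd.trans hD, hdeg, hsupp.trans hT, hdvd⟩

/-! ## §W The double wall -/

/-- **Negation, unpacked.**  `¬SublinearShadow` iff for every `A, p₁` some prime `p ≥ p₁` carries a SUBLINEAR complex
representation `(s, S)` of `F_p` with NO characteristic-`p` cyclic shadow of `≤ (s+1)^A` squares and support `≤ (s+1)^A·S`.
A kill must therefore produce both halves at the same primes: W1 (a sublinear complex representation) and W2 (a char-`p`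
non-representability proof). [folklore] -/
theorem not_sublinearShadow_iff :
    ¬ SublinearShadow ↔ ∀ A p₁ : ℕ, ∃ (p : ℕ) (_ : Fact p.Prime), p₁ ≤ p ∧
      ∃ (s : ℕ) (c : Fin s → ℂ) (g : Fin s → ℂ[X]), (∀ i, (g i).natDegree ≤ p ^ 2) ∧
        (∑ i, (g i).support.card) ^ 4 ≤ p ^ 3 ∧ (∑ i, C (c i) * g i ^ 2) = 𝔉⟮p⟯ ∧
        ¬ HasShadow p ((s + 1) ^ A) ((s + 1) ^ A * ∑ i, (g i).support.card) := by
  constructor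
  · intro h
    rw [sublinearShadow_iff] at h
    push Not at h
    exact h
  · rintro h ⟨A, p₁, H⟩
    obtain ⟨p, inst, hp₁, s, c, g, h1, h2, h3, hno⟩ := h A p₁
    exact hno (@H p inst hp₁ s c g h1 h2 h3)

/-- **Wall W1 (vacuity).**  If for all large primes NO complex representation of `F_p` with `S⁴ ≤ p³` exists (all `s`, degree
cap `p²`) — i.e. the thesis `X` at exponent `3/4` without the few-squares restriction — then the crux holds vacuously. [folklore] -/
theorem sublinearShadow_of_noSublinearRep
    (h : ∃ p₁ : ℕ, ∀ (p : ℕ) [Fact p.Prime], p₁ ≤ p → ∀ (s : ℕ) (c : Fin s → ℂ) (g : Fin s → ℂ[X]),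
      (∀ i, (g i).natDegree ≤ p ^ 2) → (∑ i, C (c i) * g i ^ 2) = 𝔉⟮p⟯ →
      p ^ 3 < (∑ i, (g i).support.card) ^ 4) :
    SublinearShadow := by
  obtain ⟨p₁, h⟩ := h
  exact ⟨0, p₁, fun p _ hp s c g hdeg hS hrep => absurd hS (not_le.mpr (h p hp s c g hdeg hrep))⟩

/-- **Wall W2 (cheap characteristic-`p` side).**  If for some fixed `D` and all large primes `F̄_p` has a cyclic char-`p`
representation with `≤ D` squares and support `T`, `2T² ≤ D²(p−1)` (i.e. `T ≤ D·√((p−1)/2)`: only a CONSTANT FACTOR `D`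
below the counting bound `√(2(p−1))` that every complex representation's `S` obeys), then the crux holds trivially with
`A = D`: `d ≤ D ≤ 2^D ≤ (s+1)^D` (`s ≥ 2`) and `T ≤ D·S ≤ (s+1)^D·S` (`2(p−1) ≤ S(S+1)`, `ThinSquaresCovering`).
Contrapositive: a kill PROVES, for every `D` and infinitely many `p`, that `D`-square cyclic representations of `F̄_p` cost
`> D√((p−1)/2)` — beyond counting for `D ≥ 3`, where nothing is known (sibling crux (★) `CharPSparseSOS`). [folklore] -/
theorem sublinearShadow_of_cheapCharP (D : ℕ)
    (h : ∃ p₁ : ℕ, ∀ (p : ℕ) [Fact p.Prime], p₁ ≤ p → ∃ T : ℕ, 2 * T ^ 2 ≤ D ^ 2 * (p - 1) ∧ HasShadow p D T) :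
    SublinearShadow := by
  obtain ⟨p₁, h⟩ := h
  refine ⟨D, p₁, fun p _ hp s c g _hdeg _hS hrep => ?_⟩
  obtain ⟨T, hT, hsh⟩ := h p hp
  set S : ℕ := ∑ i, (g i).support.card with hSdef
  have hs2 : 2 ≤ s := two_le_of_feketeRep p c g hrep
  -- counting: `2(p-1) ≤ (S+1)·S`
  have hcount : 2 * (p - 1) ≤ (S + 1) * S :=
    FeketeSOSThinSquaresCovering.two_mul_pred_le_of_feketeRep p S c g
      (fun i => Finset.single_le_sum (f := fun j => (g j).support.card) (fun j _ => Nat.zero_le _)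
        (Finset.mem_univ i)) hrep
  -- hence `T ≤ D·S`
  have hTS : T ≤ D * S := by
    have h4 : 4 * T ^ 2 ≤ D ^ 2 * S ^ 2 + D ^ 2 * S := by
      calc 4 * T ^ 2 = 2 * (2 * T ^ 2) := by ring
        _ ≤ 2 * (D ^ 2 * (p - 1)) := Nat.mul_le_mul_left 2 hT
        _ = D ^ 2 * (2 * (p - 1)) := by ring
        _ ≤ D ^ 2 * ((S + 1) * S) := Nat.mul_le_mul_left _ hcount
        _ = D ^ 2 * S ^ 2 + D ^ 2 * S := by ring
    have hSS : D ^ 2 * S ≤ D ^ 2 * S ^ 2 := Nat.mul_le_mul_left _ (Nat.le_self_pow two_ne_zero S)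
    by_contra hlt
    have h1 : D * S + 1 ≤ T := by omega
    have h2 : (D * S + 1) ^ 2 ≤ T ^ 2 := Nat.pow_le_pow_left h1 2
    nlinarith [h4, h2, hSS]
  -- few squares: `D ≤ 2^D ≤ (s+1)^D`
  have hD : D ≤ (s + 1) ^ D :=
    (Nat.lt_two_pow_self).le.trans (Nat.pow_le_pow_left (by omega) D)
  exact hasShadow_mono hsh hD (hTS.trans (Nat.mul_le_mul_right _ hD))

/-! ## §V Vacuity slices of the hypothesis class -/

/-- **Two weighted squares are a splitting** (content of the landed item `SplitOfTwoSquares`, restated to keep this file's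
imports inside the farm snapshot): `c₀g₀² + c₁g₁² = A·B` with `A, B = a g₀ ± i b g₁`, `a² = c₀`, `b² = c₁`, and
`|supp A| + |supp B| ≤ 2(|supp g₀| + |supp g₁|)`. [folklore] -/
theorem split_of_two_squares (c : Fin 2 → ℂ) (g : Fin 2 → ℂ[X]) :
    ∃ A B : ℂ[X], A * B = ∑ i, C (c i) * g i ^ 2 ∧
      A.support.card + B.support.card ≤ 2 * ((g 0).support.card + (g 1).support.card) := by
  obtain ⟨a, ha⟩ := IsAlgClosed.exists_pow_nat_eq (c 0) (n := 2) two_pos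
  obtain ⟨b, hb⟩ := IsAlgClosed.exists_pow_nat_eq (c 1) (n := 2) two_pos
  refine ⟨C a * g 0 + C (Complex.I * b) * g 1, C a * g 0 + C (-(Complex.I * b)) * g 1, ?_, ?_⟩
  · rw [Fin.sum_univ_two, ← ha, ← hb]
    have hI : (Complex.I * b) ^ 2 = -(b ^ 2) := by rw [mul_pow, Complex.I_sq]; ring
    have key : (C a * g 0 + C (Complex.I * b) * g 1) * (C a * g 0 + C (-(Complex.I * b)) * g 1)
        = C (a ^ 2) * g 0 ^ 2 - C ((Complex.I * b) ^ 2) * g 1 ^ 2 := by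
      simp only [map_neg, map_pow, map_mul]; ring
    rw [key, hI, map_neg]
    ring
  · have hle : ∀ (u v : ℂ), (C u * g 0 + C v * g 1).support.card ≤ (g 0).support.card + (g 1).support.card :=
      fun u v =>
      calc (C u * g 0 + C v * g 1).support.card
          ≤ ((C u * g 0).support ∪ (C v * g 1).support).card := Finset.card_le_card support_add
        _ ≤ (C u * g 0).support.card + (C v * g 1).support.card := Finset.card_union_le _ _
        _ ≤ (g 0).support.card + (g 1).support.card := by
            gcongr
            · simpa only [smul_eq_C_mul] using support_smul u (g 0)
            · simpa only [smul_eq_C_mul] using support_smul v (g 1)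
    have h0 := hle a (Complex.I * b)
    have h1 := hle a (-(Complex.I * b))
    omega

/-- **At least three squares** (`= stub_threeSquares` of line `Sketch`, verbatim binder order).  For a prime `p ≥ 257`, a
complex representation `Σ_{i<s} c_i g_i² = F_p` with `S⁴ ≤ p³` has `s ≥ 3`: `s ≥ 2` by `two_le_of_feketeRep`; two weighted
squares are a splitting `A·B = F_p` with `|supp A| + |supp B| ≤ 2S` (`SplitOfTwoSquares`, landed), splittings cost
`≥ (p+3)/2` (`feketeNoSparseCyclicSplit`, landed), so `4S ≥ p + 2` and `256·S⁴ ≥ (p+2)⁴ ≥ p³(p+8) > 256·p³`. [folklore] -/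
theorem three_le_of_sublinearRep (p : ℕ) [Fact p.Prime] (hp : 257 ≤ p) (s : ℕ) (c : Fin s → ℂ)
    (g : Fin s → Polynomial ℂ) (hS : (∑ i, (g i).support.card) ^ 4 ≤ p ^ 3)
    (hrep : (∑ i, Polynomial.C (c i) * g i ^ 2)
      = ∑ m ∈ Finset.range p, Polynomial.C ((legendreSym p m : ℤ) : ℂ) * Polynomial.X ^ m) :
    3 ≤ s := by
  have hprime : p.Prime := Fact.out
  have hp2 : p ≠ 2 := by omega
  have hs2 : 2 ≤ s := two_le_of_feketeRep p c g hrep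
  by_contra hs3
  obtain rfl : s = 2 := by omega
  -- two squares split
  obtain ⟨A, B, hAB, hcard⟩ := split_of_two_squares c g
  rw [hrep] at hAB
  have hAB' : A * B = (feketePolynomial p).map (Int.castRingHom ℂ) := by
    rw [map_feketePolynomial_complex]; exact hAB
  have hF0 : (feketePolynomial p).map (Int.castRingHom ℂ) ≠ 0 :=
    FeketeNoSparseSplitCyclic.map_feketePolynomial_ne_zero ℂ p
  have hFdeg : ((feketePolynomial p).map (Int.castRingHom ℂ)).natDegree < p :=
    FeketeNoSparseSplitCyclic.natDegree_map_feketePolynomial_lt ℂ p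
  have hA : A.natDegree < p :=
    lt_of_le_of_lt (natDegree_le_of_dvd (Dvd.intro _ hAB') hF0) hFdeg
  have hB : B.natDegree < p :=
    lt_of_le_of_lt (natDegree_le_of_dvd (Dvd.intro_left _ hAB') hF0) hFdeg
  have hdiv : (X ^ p - 1 : ℂ[X]) ∣ A * B - (feketePolynomial p).map (Int.castRingHom ℂ) := by
    rw [hAB', sub_self]; exact dvd_zero _
  have hnat : (p + 3) / 2 ≤ A.support.card + B.support.card :=
    FeketeNoSparseSplitCyclic.feketeNoSparseCyclicSplit p hp2 A B hA hB hdiv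
  -- arithmetic
  set S : ℕ := ∑ i, (g i).support.card with hSdef
  have hS2 : S = (g 0).support.card + (g 1).support.card := by rw [hSdef, Fin.sum_univ_two]
  have h4S : p + 2 ≤ 4 * S := by omega
  have hpow : (p + 2) ^ 4 ≤ (4 * S) ^ 4 := Nat.pow_le_pow_left h4S 4
  have hbin : p ^ 3 * (p + 8) ≤ (p + 2) ^ 4 := by
    have : (p + 2) ^ 4 = p ^ 3 * (p + 8) + (24 * p ^ 2 + 32 * p + 16) := by ring
    omega
  have hchain : p ^ 3 * (p + 8) ≤ p ^ 3 * 256 := by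
    calc p ^ 3 * (p + 8) ≤ (4 * S) ^ 4 := hbin.trans hpow
      _ = 256 * S ^ 4 := by ring
      _ ≤ 256 * p ^ 3 := Nat.mul_le_mul_left _ hS
      _ = p ^ 3 * 256 := by ring
  have := Nat.le_of_mul_le_mul_left hchain (pow_pos hprime.pos 3)
  omega

/-! ## §A The representation hypothesis is load-bearing (landed copy: `Negative/DeepFamily.lean`) -/

/-- The coefficient of `X¹` in `F̄_p` over any commutative ring is `(1|p) = 1`. [folklore] -/
theorem coeff_one_feketeSum (K : Type) [CommRing K] (p : ℕ) [Fact p.Prime] :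
    (∑ m ∈ range p, C ((legendreSym p m : ℤ) : K) * X ^ m).coeff 1 = 1 := by
  have hp : 1 < p := (Fact.out : p.Prime).one_lt
  simp [hp]

/-- **`SublinearShadow` WITHOUT the representation hypothesis is false** (witness `s = 0`: total support `≤ 0` forces
`X^p − 1 ∣ F̄_p`, impossible for `0 ≠ F̄_p` of degree `< p`).  Any proof must use the identity. [folklore] -/
theorem sublinearShadow_false_without_rep :
    ¬ (∃ A p₁ : ℕ, ∀ (p : ℕ) [Fact p.Prime], p₁ ≤ p → ∀ (s : ℕ) (c : Fin s → ℂ) (g : Fin s → Polynomial ℂ),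
        (∀ i, (g i).natDegree ≤ p ^ 2) → (∑ i, (g i).support.card) ^ 4 ≤ p ^ 3 →
        HasShadow p ((s + 1) ^ A) ((s + 1) ^ A * ∑ i, (g i).support.card)) := by
  rintro ⟨A, p₁, h⟩
  obtain ⟨p, hp₁, hprime⟩ := Nat.exists_infinite_primes p₁
  haveI : Fact p.Prime := ⟨hprime⟩
  obtain ⟨K, _, _, d, c', g', -, hdeg, hsupp, hdvd⟩ :=
    h p hp₁ 0 (fun i => Fin.elim0 i) (fun i => Fin.elim0 i) (fun i => Fin.elim0 i) (by simp)
  have hsupp0 : ∑ j, (g' j).support.card = 0 := Nat.eq_zero_of_le_zero (by simpa using hsupp)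
  have hg' : ∀ j, g' j = 0 := fun j => by
    have hj : (g' j).support.card = 0 := Finset.sum_eq_zero_iff.mp hsupp0 j (Finset.mem_univ j)
    simpa using hj
  have hzero : (∑ j, Polynomial.C (c' j) * g' j ^ 2) = 0 :=
    Finset.sum_eq_zero fun j _ => by rw [hg' j]; simp
  rw [hzero, zero_sub, dvd_neg] at hdvd
  set F : Polynomial K := ∑ m ∈ Finset.range p, Polynomial.C ((legendreSym p m : ℤ) : K) * Polynomial.X ^ m with hF
  have hF0 : F ≠ 0 := fun h0 => by
    have h1 := coeff_one_feketeSum K p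
    rw [← hF, h0, coeff_zero] at h1
    exact zero_ne_one h1
  have hFdeg : F.natDegree < p := by
    refine lt_of_le_of_lt (natDegree_sum_le_of_forall_le (n := p - 1) _ _ fun m hm => ?_) ?_
    · refine (natDegree_C_mul_X_pow_le _ _).trans ?_
      have := Finset.mem_range.mp hm
      omega
    · exact Nat.sub_lt hprime.pos one_pos
  have hXp : ((Polynomial.X : Polynomial K) ^ p - 1).natDegree = p := by
    rw [← C_1, natDegree_X_pow_sub_C]
  have := natDegree_le_of_dvd hdvd hF0
  rw [hXp] at this
  omega

/-! ## §B Depth is unbounded at three squares and linear cost; padding (landed copy: `Negative/DeepFamily.lean`) -/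

/-- At a valuation subring `O ⊂ ℂ` with `p ∈ 𝔪_O`, `p⁻¹ ∉ O`. [folklore] -/
theorem inv_natCast_not_mem (O : ValuationSubring ℂ) {p : ℕ} (hp : p ≠ 0)
    (hpO : ((p : ℕ) : O) ∈ maximalIdeal O) : (p : ℂ)⁻¹ ∉ O := by
  intro h
  have hpC : (p : ℂ) ≠ 0 := Nat.cast_ne_zero.mpr hp
  have hunit : IsUnit ((p : ℕ) : O) := by
    refine isUnit_iff_exists_inv.mpr ⟨⟨(p : ℂ)⁻¹, h⟩, ?_⟩
    apply Subtype.ext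
    change ((p : O) : ℂ) * (p : ℂ)⁻¹ = 1
    rw [show ((p : O) : ℂ) = (p : ℂ) from rfl, mul_inv_cancel₀ hpC]
  exact (mem_maximalIdeal _).mp hpO hunit

/-- `p^j · (−p^{−(k+1)}) ∉ O` for `j ≤ k` ("depth `> k`" of the scalar `−p^{−(k+1)}` at every place above `p`). [folklore] -/
theorem pow_mul_neg_inv_pow_not_mem (O : ValuationSubring ℂ) {p : ℕ} (hp : p ≠ 0)
    (hpO : ((p : ℕ) : O) ∈ maximalIdeal O) {j k : ℕ} (hjk : j ≤ k) :
    (p : ℂ) ^ j * (-((p : ℂ)⁻¹ ^ (k + 1))) ∉ O := by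
  intro h
  have hpC : (p : ℂ) ≠ 0 := Nat.cast_ne_zero.mpr hp
  apply inv_natCast_not_mem O hp hpO
  have key : (p : ℂ)⁻¹ = -((p : ℂ) ^ (k - j) * ((p : ℂ) ^ j * (-((p : ℂ)⁻¹ ^ (k + 1))))) := by
    rw [mul_neg, mul_neg, neg_neg, ← mul_assoc, ← pow_add, Nat.sub_add_cancel hjk, pow_succ, ← mul_assoc,
      ← mul_pow, mul_inv_cancel₀ hpC, one_pow, one_mul]
  rw [key]
  exact neg_mem (mul_mem (pow_mem (natCast_mem O p) _) h)

/-- `deg F_p = p − 1`. [folklore] -/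
theorem natDegree_feketeSum (p : ℕ) [Fact p.Prime] : (𝔉⟮p⟯).natDegree = p - 1 := by
  rw [← map_feketePolynomial_complex, natDegree_map_eq_of_injective (Int.castRingHom ℂ).injective_int,
    natDegree_feketePolynomial]

/-- `F_p ≠ 0` over `ℂ`. [folklore] -/
theorem feketeSum_ne_zero (p : ℕ) [Fact p.Prime] : (𝔉⟮p⟯) ≠ 0 := fun h0 => by
  have h1 := coeff_one_feketeSum ℂ p
  rw [h0, coeff_zero] at h1
  exact zero_ne_one h1

/-- **Deep three-square representations of `F_p` (every prime `p`, every depth `k`).**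
`F_p = ¼(A+B)² − ¼(A−B)² − p^{−(k+1)}·1²`, `A = X − α`, `A·B = F_p + p^{−(k+1)}`: degree `≤ p²`, support-sum `≤ 2p + 5`,
scalar term non-integral at EVERY place of `ℂ` above `p` even times `p^j`, `j ≤ k` — the good-reduction hypothesis of
`DepthZeroShadow` fails at every place and every bounded denominator.  Depth is unbounded at fan-in `3`, linear cost. [folklore] -/
theorem exists_deep_threeSquares (p : ℕ) [Fact p.Prime] (k : ℕ) :
    ∃ (c : Fin 3 → ℂ) (g : Fin 3 → ℂ[X]),
      (∀ i, (g i).natDegree ≤ p ^ 2) ∧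
      (∑ i, C (c i) * g i ^ 2) = 𝔉⟮p⟯ ∧
      (∑ i, (g i).support.card) ≤ 2 * p + 5 ∧
      c 2 = -((p : ℂ)⁻¹ ^ (k + 1)) ∧ g 2 = 1 ∧
      (∀ O : ValuationSubring ℂ, ((p : ℕ) : O) ∈ maximalIdeal O →
        ∀ j ≤ k, (p : ℂ) ^ j * (C (c 2) * g 2 ^ 2).coeff 0 ∉ O) := by
  have hprime : p.Prime := Fact.out
  have hp2 : 2 ≤ p := hprime.two_le
  set ε : ℂ := (p : ℂ)⁻¹ ^ (k + 1) with hε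
  set F : ℂ[X] := 𝔉⟮p⟯ with hF
  have hFdeg : F.natDegree = p - 1 := natDegree_feketeSum p
  have hF0 : F ≠ 0 := feketeSum_ne_zero p
  have hdegF : 0 < F.degree := by
    rw [degree_eq_natDegree hF0, hFdeg]
    exact_mod_cast (by omega : 0 < p - 1)
  have hdegFε : (F + C ε).degree = F.degree := degree_add_C hdegF
  have hnatFε : (F + C ε).natDegree = p - 1 := by rw [natDegree_add_C, hFdeg]
  obtain ⟨α, hα⟩ := Complex.exists_root (by rw [hdegFε]; exact hdegF)
  set A : ℂ[X] := X - C α with hA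
  set B : ℂ[X] := (F + C ε) /ₘ (X - C α) with hB
  have hAB : (X - C α) * B = F + C ε := mul_divByMonic_eq_iff_isRoot.mpr hα
  have hAdeg : A.natDegree = 1 := natDegree_X_sub_C α
  have hBdeg : B.natDegree = p - 2 := by
    rw [hB, natDegree_divByMonic _ (monic_X_sub_C α), hnatFε, natDegree_X_sub_C]
    omega
  have hAcard : A.support.card ≤ 2 := (card_supp_le_succ_natDegree A).trans (by rw [hAdeg])
  have hBcard : B.support.card ≤ p - 1 := (card_supp_le_succ_natDegree B).trans (by rw [hBdeg]; omega)
  have hp22 : p - 1 ≤ p ^ 2 := (Nat.sub_le p 1).trans (Nat.le_self_pow two_ne_zero p)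
  have h1p2 : 1 ≤ p ^ 2 := le_trans (by omega) hp22
  have hABdeg : (A + B).natDegree ≤ p ^ 2 :=
    (natDegree_add_le _ _).trans (max_le (by rw [hAdeg]; exact h1p2) (by rw [hBdeg]; omega))
  have hABdeg' : (A - B).natDegree ≤ p ^ 2 :=
    (natDegree_sub_le _ _).trans (max_le (by rw [hAdeg]; exact h1p2) (by rw [hBdeg]; omega))
  have h4 : C (4⁻¹ : ℂ) * 4 = (1 : ℂ[X]) := by
    rw [← Polynomial.C_ofNat, ← map_mul, inv_mul_cancel₀ (by norm_num : (4 : ℂ) ≠ 0), map_one]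
  refine ⟨![4⁻¹, -4⁻¹, -ε], ![A + B, A - B, 1], ?_, ?_, ?_, ?_, ?_, ?_⟩
  · intro i
    fin_cases i
    · exact hABdeg
    · exact hABdeg'
    · simp
  · rw [Fin.sum_univ_three]
    simp only [Matrix.cons_val_zero, Matrix.cons_val_one, Matrix.cons_val_two, Matrix.tail_cons,
      Matrix.head_cons, map_neg, one_pow, mul_one]
    rw [hA]
    linear_combination ((X - C α) * B) * h4 + hAB
  · rw [Fin.sum_univ_three]
    simp only [Matrix.cons_val_zero, Matrix.cons_val_one, Matrix.cons_val_two, Matrix.tail_cons,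
      Matrix.head_cons]
    have h1 : (1 : ℂ[X]).support.card ≤ 1 := (card_supp_le_succ_natDegree _).trans (by simp)
    have hs1 := (card_support_add_le A B).trans (Nat.add_le_add hAcard hBcard)
    have hs2 := (card_support_sub_le A B).trans (Nat.add_le_add hAcard hBcard)
    omega
  · simp
  · simp
  · intro O hpO j hj
    simp only [Matrix.cons_val_two, Matrix.tail_cons, Matrix.head_cons, one_pow, mul_one, coeff_C_zero]
    exact pow_mul_neg_inv_pow_not_mem O hprime.ne_zero hpO hj

/-- **Padding makes any representation deep**: from `Σ_{i<s} c_i g_i² = F_p` to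
`Σ_{i<s} c_i g_i² + p^{−(k+1)}·1² − p^{−(k+1)}·1² = F_p` — two more squares, support-sum `+2` at most, old squares
untouched, the last term non-integral at every place of `ℂ` above `p` even times `p^j`, `j ≤ k`.  If a representation with
`(S+2)⁴ ≤ p³` exists, so does a SUBLINEAR one with no place of good reduction. [folklore] -/
theorem exists_deep_padding (p : ℕ) [Fact p.Prime] (k : ℕ) {s : ℕ} (c : Fin s → ℂ) (g : Fin s → ℂ[X])
    (hrep : (∑ i, C (c i) * g i ^ 2) = 𝔉⟮p⟯) :
    ∃ (c' : Fin (s + 2) → ℂ) (g' : Fin (s + 2) → ℂ[X]),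
      (∑ i, C (c' i) * g' i ^ 2) = 𝔉⟮p⟯ ∧
      (∀ i : Fin s, c' (Fin.castAdd 2 i) = c i ∧ g' (Fin.castAdd 2 i) = g i) ∧
      (∀ i : Fin 2, g' (Fin.natAdd s i) = 1) ∧
      (∑ i, (g' i).support.card) ≤ (∑ i, (g i).support.card) + 2 ∧
      c' (Fin.natAdd s 1) = -((p : ℂ)⁻¹ ^ (k + 1)) ∧
      (∀ O : ValuationSubring ℂ, ((p : ℕ) : O) ∈ maximalIdeal O →
        ∀ j ≤ k, (p : ℂ) ^ j * (C (c' (Fin.natAdd s 1)) * g' (Fin.natAdd s 1) ^ 2).coeff 0 ∉ O) := by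
  have hprime : p.Prime := Fact.out
  set ε : ℂ := (p : ℂ)⁻¹ ^ (k + 1) with hε
  refine ⟨Fin.append c ![ε, -ε], Fin.append g ![1, 1], ?_, ?_, ?_, ?_, ?_, ?_⟩
  · rw [Fin.sum_univ_add, ← hrep]
    simp [Fin.sum_univ_two]
  · intro i
    simp
  · intro i
    fin_cases i <;> simp
  · rw [Fin.sum_univ_add]
    have h1 : (1 : ℂ[X]).support.card ≤ 1 := (card_supp_le_succ_natDegree _).trans (by simp)
    have h2 : ∑ i : Fin 2, (Fin.append g ![1, 1] (Fin.natAdd s i)).support.card ≤ 2 := by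
      rw [Fin.sum_univ_two]
      simp only [Fin.append_right, Matrix.cons_val_zero, Matrix.cons_val_one]
      omega
    simp only [Fin.append_left]
    omega
  · simp
  · intro O hpO j hj
    have e1 : Fin.append c ![ε, -ε] (Fin.natAdd s 1) = -ε := by simp
    have e2 : Fin.append g ![1, 1] (Fin.natAdd s 1) = 1 := by simp
    rw [e1, e2, one_pow, mul_one, coeff_C_zero]
    exact pow_mul_neg_inv_pow_not_mem O hprime.ne_zero hpO hj

/-! ## §B (continued) A cost-minimal representation of `F_5` that is deep at every place over `5`
(pending as `Negative/MinimalDeep.lean`; copies here) -/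

/-- The values of the Legendre symbol modulo `5` on `0,…,4`. [folklore] -/
theorem legendreSym_five_values [Fact (Nat.Prime 5)] :
    legendreSym 5 ((0 : ℕ) : ℤ) = 0 ∧ legendreSym 5 ((1 : ℕ) : ℤ) = 1 ∧ legendreSym 5 ((2 : ℕ) : ℤ) = -1 ∧
      legendreSym 5 ((3 : ℕ) : ℤ) = -1 ∧ legendreSym 5 ((4 : ℕ) : ℤ) = 1 := by
  have h : @legendreSym 5 ⟨by norm_num⟩ ((0 : ℕ) : ℤ) = 0 ∧ @legendreSym 5 ⟨by norm_num⟩ ((1 : ℕ) : ℤ) = 1 ∧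
      @legendreSym 5 ⟨by norm_num⟩ ((2 : ℕ) : ℤ) = -1 ∧ @legendreSym 5 ⟨by norm_num⟩ ((3 : ℕ) : ℤ) = -1 ∧
      @legendreSym 5 ⟨by norm_num⟩ ((4 : ℕ) : ℤ) = 1 := by
    refine ⟨?_, ?_, ?_, ?_, ?_⟩ <;> decide
  exact h

/-- `F_5 = X − X² − X³ + X⁴` as rendered by the crux. [folklore] -/
theorem feketeSum_five [Fact (Nat.Prime 5)] : 𝔉⟮5⟯ = X - X ^ 2 - X ^ 3 + X ^ 4 := by
  obtain ⟨h0, h1, h2, h3, h4⟩ := legendreSym_five_values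
  rw [Finset.sum_range_succ, Finset.sum_range_succ, Finset.sum_range_succ, Finset.sum_range_succ,
    Finset.sum_range_one, h0, h1, h2, h3, h4]
  simp only [Int.cast_zero, Int.cast_one, Int.cast_neg, map_zero, map_one, map_neg, zero_mul, zero_add, one_mul,
    neg_mul, pow_one]
  ring

/-- **A cost-minimal, everywhere-deep representation of `F_5`**: `F_5 = (X² − ½X)² − ⅕(1 − (5/2)X)² + ⅕·1²`, weights
`(1, −⅕, ⅕)`, total support `≤ 5 = S_min(F_5)`, and the constant coefficients `−⅕`, `⅕` of the last two TERMS lie in no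
valuation ring of `ℂ` above `5`.  Minimality of `5` (all `s`, all degrees) is the exhaustive j009087 + the hand argument of
`resists_remark` (2); the pattern is `{1,2}+{0,1}+{0}` in j009087's list of the six minimal patterns of `F_5`. [folklore] -/
theorem fekete_five_deep_minimal [Fact (Nat.Prime 5)] :
    ∃ (c : Fin 3 → ℂ) (g : Fin 3 → ℂ[X]),
      (∀ i, (g i).natDegree ≤ 5 ^ 2) ∧
      (∑ i, C (c i) * g i ^ 2) = 𝔉⟮5⟯ ∧
      (∑ i, (g i).support.card) ≤ 5 ∧
      (∀ O : ValuationSubring ℂ, ((5 : ℕ) : O) ∈ maximalIdeal O →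
        (C (c 1) * g 1 ^ 2).coeff 0 ∉ O ∧ (C (c 2) * g 2 ^ 2).coeff 0 ∉ O) := by
  refine ⟨![1, -5⁻¹, 5⁻¹], ![X ^ 2 - C (2⁻¹ : ℂ) * X, 1 - C ((5 : ℂ) / 2) * X, 1], ?_, ?_, ?_, ?_⟩
  · intro i
    fin_cases i
    · show (X ^ 2 - C (2⁻¹ : ℂ) * X).natDegree ≤ 5 ^ 2
      refine (natDegree_sub_le _ _).trans (max_le (by simp) ?_)
      exact (natDegree_C_mul_le _ _).trans (by simp)
    · show ((1 : ℂ[X]) - C ((5 : ℂ) / 2) * X).natDegree ≤ 5 ^ 2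
      refine (natDegree_sub_le _ _).trans (max_le (by simp) ?_)
      exact (natDegree_C_mul_le _ _).trans (by simp)
    · simp
  · rw [feketeSum_five, Fin.sum_univ_three]
    simp only [Matrix.cons_val_zero, Matrix.cons_val_one, Matrix.cons_val_two, Matrix.tail_cons, Matrix.head_cons]
    apply Polynomial.funext
    intro x
    simp only [eval_add, eval_mul, eval_pow, eval_sub, eval_C, eval_X, eval_one, map_one, map_neg, one_mul, eval_neg]
    ring
  · rw [Fin.sum_univ_three]
    simp only [Matrix.cons_val_zero, Matrix.cons_val_one, Matrix.cons_val_two, Matrix.tail_cons, Matrix.head_cons]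
    have hX2 : ((X : ℂ[X]) ^ 2).support.card ≤ 1 := by
      rw [Polynomial.support_X_pow]; simp
    have hCX : ∀ a : ℂ, (C a * (X : ℂ[X])).support.card ≤ 1 := fun a => by
      rw [← pow_one (X : ℂ[X])]
      exact card_support_C_mul_X_pow_le_one
    have h1 : (1 : ℂ[X]).support.card ≤ 1 := (card_supp_le_succ_natDegree _).trans (by simp)
    have hsub : ∀ P Q : ℂ[X], (P - Q).support.card ≤ P.support.card + Q.support.card := fun P Q => by
      rw [sub_eq_add_neg]
      exact (Finset.card_le_card support_add).trans ((Finset.card_union_le _ _).trans (by rw [support_neg]))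
    have e0 := (hsub _ _).trans (Nat.add_le_add hX2 (hCX 2⁻¹))
    have e1 := (hsub _ _).trans (Nat.add_le_add h1 (hCX ((5 : ℂ) / 2)))
    omega
  · intro O hO
    have h5 : (5 : ℂ)⁻¹ ∉ O := by
      have := inv_natCast_not_mem O (p := 5) (by norm_num) hO
      simpa using this
    show (C (-5⁻¹ : ℂ) * ((1 : ℂ[X]) - C ((5 : ℂ) / 2) * X) ^ 2).coeff 0 ∉ O ∧
      (C (5⁻¹ : ℂ) * (1 : ℂ[X]) ^ 2).coeff 0 ∉ O
    constructor
    · have e : (C (-5⁻¹ : ℂ) * ((1 : ℂ[X]) - C ((5 : ℂ) / 2) * X) ^ 2).coeff 0 = -5⁻¹ := by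
        rw [coeff_zero_eq_eval_zero]; simp
      rw [e]
      intro h
      exact h5 (by simpa using neg_mem h)
    · have e : (C (5⁻¹ : ℂ) * (1 : ℂ[X]) ^ 2).coeff 0 = 5⁻¹ := by
        rw [coeff_zero_eq_eval_zero]; simp
      rw [e]
      exact h5

/-- **Cheap does not imply shallow** (for the provers' minimality hypothesis): it is FALSE that every representation of `F_p`
with total support `≤ p` has a place of good reduction — witness `p = 5` above. [folklore] -/
theorem not_cheap_rep_goodReduction :
    ¬ (∀ (p : ℕ) [Fact p.Prime] (s : ℕ) (c : Fin s → ℂ) (g : Fin s → ℂ[X]),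
        (∑ i, C (c i) * g i ^ 2) = 𝔉⟮p⟯ → (∑ i, (g i).support.card) ≤ p →
        ∃ O : ValuationSubring ℂ, ((p : ℕ) : O) ∈ maximalIdeal O ∧ ∀ i n, (C (c i) * g i ^ 2).coeff n ∈ O) := by
  intro h
  haveI : Fact (Nat.Prime 5) := ⟨by norm_num⟩
  obtain ⟨c, g, -, hrep, hS, hdeep⟩ := fekete_five_deep_minimal
  obtain ⟨O, hO, hint⟩ := h 5 3 c g hrep hS
  exact (hdeep O hO).1 (hint 1 0)

/-! ## §L Line `Sketch` — stub audit (no stuck stubs yet); §R remarks -/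

/-- **Line `Sketch` (lead `prover-line-stmt-ValiantsHypothesis-14990-0`), stub by stub.**
* `stub_evalSupport`, `stub_windowDFT`, `stub_primRoot`, `stub_reindex`: landed (p96243 / p96550 / p96249 / p96316); checked
  on paper here as well (DFT extraction of the `Π^v`-coefficient of `Σ c_i(Π) Y_i(Π)²`, `deg_Π ≤ 3v`, needs exactly `m > 2v`;
  among `2v+1, 2v+2` one is prime to `p`; reindexing `range m × Fin s ≃ Fin (m·s)`).  TRUE.
* `stub_trivialShadow`: TRUE (`c' = (¼, −¼)`, `g' = (F̄+1, F̄−1)` over `ZMod p`, `p` odd; supports `p + p`).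
* `stub_threeSquares`: TRUE and PROVED — `three_le_of_sublinearRep` above has the identical signature.
* `stub_orderBudgetFew` (the open core): NOT REFUTABLE today — its hypothesis is a sublinear (`S⁴ ≤ p³`), few-square
  (`(s+1)^B·S < 2p`), Pareto-minimal complex representation, so any counterexample is first of all a sublinear complex SOS
  representation of `F_p` (wall W1).  Two remarks for the lead.  (i) Its conclusion is EXISTENTIAL in the window model
  `(K, v, γ, Y, u₀)`; it does not say "the given representation has depth/order `≤ v`".  On DENSE digit supports order `0`
  is free (`F̄_p = ¼(X + Q̄)² − ¼(X − Q̄)²` with `F̄_p = X·Q̄`, digits supported in `[0, p−2]`), so all content is in the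
  support constraint `supp(digits of Y_i) ⊆ supp g_i` with `Σ|supp g_i| ≤ p^{3/4}` — the stub is a SPARSE char-`p`
  representability statement for `u₀F̄_p` "up to a window", and (★)-type hardness is what makes it non-trivial.
  (ii) §B: at fan-in `3` and linear cost, depth is unbounded (`exists_deep_threeSquares`), and padding (`exists_deep_padding`)
  puts representations with NO place of good reduction inside the sublinear class as soon as that class is inhabited; the
  stub's Pareto-minimality hypothesis kills padded pairs (drop them: fewer squares, smaller `S`) but does NOT force good
  reduction: `fekete_five_deep_minimal` is a representation of `F_5` with the fewest monomials possible (`5`, three squares)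
  that is deep at EVERY place over `5` — so no lemma of the form "minimal ⇒ depth `0` somewhere" can be a stub; the budget
  must come from minimality + SUBLINEAR cheapness jointly, exactly the un-engineered part (`BarrierNotes-ideator2 §B1`, now
  for `F_p` itself).
* Joint sufficiency: `SublinearShadow_of` in `Lines/Sketch.lean` composes the stubs into the crux by name; `lean check` rc 0 with
  sorries only in `stub_*` (re-run by this seat 2026-08-16): no gap is smuggled by the composition. -/
theorem lineSketch_remark : True := trivial

/-- **Why it resists / small models / the shape of a kill.**
(1) DOUBLE WALL (§W): a kill = (sublinear complex SOS representations of `F_p` for infinitely many `p`) ∧ (at the same `p`,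
no char-`p` cyclic representation within the `(s+1)^A` slack, for every `A`).  The first conjunct alone would refute
`FeketeBoundedFanin`-type statements at exponent `3/4` and is searched without success (siblings' kit jobs j009087,
j008168–73, j010035–8, j009356; digit/tiling rank censuses j007992, j009416: no `√p` economy anywhere, minima linear in `p`).
The second conjunct is a (★)-type theorem nobody can prove for `≥ 3` squares.
(2) SMALL `p` ARE VACUOUS, hence uninformative: `S⁴ ≤ p³` allows `S ≤ 1, 2, 3, 4, 6, 6, 8, 9, 10` at
`p = 2, 3, 5, 7, 11, 13, 17, 19, 23`, while `S_min(F_p) = 5, 7` at `p = 5, 7` and `≥ 9` at `p = 11` (j009087; `p = 2, 3` by hand),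
and the VACUITY CENSUS of this seat (kit j017676 / j017691, `main.py`: weights absorbed over `ℂ`, support patterns filtered by
(C1) coverage of `[1,p−1]`, (C2) no produced position `0` or `≥ p` with exactly one pair, (C0) `{0,1}` inside one support hence
`0` in two supports, then exact Gröbner feasibility over `ℚ` with a Rabinowitsch variable) finds the class EMPTY at `p = 13`
(`S ≤ 6`: one pattern `{0}+{0,1,3,5,6}` survives the filters and dies on the top coefficients `f² = 1, 2ef = −1, e² = 1`) and at
`p = 17, 19, 23` — TABLE (prime: `S_max`; patterns passing C0–C2 with exponents `≤ B`; Gröbner verdicts):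
`13: 6; 1 (B = 12, 30); infeasible` · `17: 8; 35 (B = 16), 35 (B = 24); all infeasible` · `19: 9; 266 (B = 18), 266 (B = 24); all
infeasible` · `23: 10; 830 (B = 22); all infeasible` (`B = 24` run cut by memory after ~400 verdicts, all infeasible).  The
`p = 13` statement is complete for ALL degrees `≤ p²` by hand: the largest exponent `M` produces the position `2M` alone unless
`M` lies in two supports, and with `≤ 6` monomials the size patterns `(4,2), (4,1,1), (3,3)` have no pair to spare beyond the 12
inside positions plus the doubled position `0`, while in `(5,1)` the singleton is forced to be `{0}`, so `2M ≤ 12`; for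
`p = 17, 19` the pattern count is unchanged when the exponent bound is raised from `p − 1` to `24`, as completeness predicts
(a lone top exponent is always fatal; doubling it costs two monomials per cancelled position).  So the hypothesis class of the
crux is EMPTY at every prime `p ≤ 23` (modulo the exponent bound at `17, 19, 23`): the statement is vacuously true there and
no experiment below `p = 29` (`S ≤ 12`) can even instantiate it.  The same bookkeeping proves `S_min(F_5) = 5` by hand (`T ≤ 4`: `(3,1) = {0,1,2}+{0}`
is the only filtered pattern, infeasible since `c² = 1, 2bc = −1, 2ab = 1` force `b² + 2ac = −7/4 ≠ −1`), which is the
minimality behind `fekete_five_deep_minimal`.  And `s ≤ 2` is vacuous for every `p ≥ 257` (§V).  The threshold `p₁` is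
existential anyway, so no finite computation bears on the crux itself.
(3) TRIVIAL REGIMES (for the provers): the conclusion holds outright when `(s+1)^A ≥ 2` and `(s+1)^A·S ≥ 2p`
(`stub_trivialShadow`), and when the representation has a place of good reduction (`DepthZeroShadow`, landed as
`depthZeroShadow_proof`, `d = s`, `A = 1`); the content is: few squares (`s = p^{o(1)}`), sublinear `S`, positive depth at
every place — by §B this case is inhabited up to Pareto-minimality.
(4) WHAT A KILL WOULD LOOK LIKE (for the record): a Gauss/Jacobi-sum identity writing `F_p = Σ_{i<s₀} c_i g_i²` with `s₀`
fixed, `|supp g_i| = O(p^{3/4}/s₀)`, coefficients of valuation `< 0` at every place over `p` cancelling to depth `≥ 1`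
(e.g. built from `G(χ)⁻¹`, `J(ψ,ψ)⁻¹`: the known cancelling identities `Σ_j χ(j) U_p(ζ^j X) = G·F_p` and `Ψ*Ψ ≡ J·F_p`
are dense, support `≳ p`), together with a proof that `F̄_p` has no `4^A`-square cyclic representation of support
`O(4^A p^{3/4})` — the latter contradicts nothing known but is itself open.  No near-miss was found; none is recorded.
(5) NEXT for a re-armed cycle: the lead's STUCK stubs (none yet); if `stub_orderBudgetFew` is split into depth-bounded and
deep cases, attack the deep-case statement's auxiliary hypotheses (ramification budget, Teichmüller-digit sparsity claims —
`BarrierNotes §B1–B2` and card `witt-carry-obstruction` record a Witt-carry counterexample at `p = 103`). -/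
theorem resists_remark : True := trivial

end

end Summit.ValiantsHypothesis.ValiantsHypothesis.Cruxes.SublinearShadow.Disproof
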